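import Summits.QuantumFields.BalabanUV.Beta.GAN24.CombesThomasFibreStep
import Summits.QuantumFields.BalabanUV.Beta.GAN24.MonotoneCauchy

/-!
# Beta / GAN24 / MonotoneFibre — (MONO-K)₂ for the WALL's resolvent slot, read at the fibre level (gan24-p4 × gan24-p1's dictionary)
# BINDER-OWNERS row G-an2-4 ∕ (CONV-C), ALTERNATIVE DISCHARGE «rate OR monotonicity»; NOT IN PRINT — our proof attempt

HONEST FRAMING (page 1 of everything the β sub-cell writes): discharging `BetaPertH` makes Bałaban's UV stability UNCONDITIONAL — a
real constructive-QFT result; it is NOT the continuum limit and NOT the Clay problem.  HONEST DEPENDENCY (cell reorg 2026-08-19, verbatim):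
«continuum YM on T⁴ ⇐ BetaPertH ∧ nine spine estimates (0/9 proved); BetaPertH ⇐ (D1) ∧ (D4) ∧ CAP+tail; G-an2-4 gates asym, D1 and NE2/3/4.»
HONEST LABEL: «not in print; our proof attempt; alternative discharge of the G-an2-4 row (rate OR monotonicity)»; 0 binders instantiated.

ABSOLUTE RULE (cell charter, verbatim): "No internally-minted statement may enter as a cited fact. Every hypothesis is either
kernel-proved in this package or a verbatim quotation of a PUBLISHED theorem with page reference. The manuscript(s) under audit are
NOT citable for their own disputed steps — they are the thing under adjudication; programme-internal (2001/route/tribunal) claims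
are never citable."  Nothing is cited; [folklore] throughout.

## WHAT IS HERE.  Road P1 (gan24-p1, `GAN24/CombesThomasFibreStep.supRateK_of_kFib`) reduced its located input (I2) `SupRateK` to an entrywise
REAL-ZONE RATE `‖kFib (j+1) p − kFib j p‖ ≤ c θ^j` of the explicit finite phase-dressed sums `kFib` of inverse-fibre entries.  Road P4's structural
input (MONO-K)₂ = `MonotoneCauchy.SupCauchyBand` for the SAME unit-normalised step resolvents `unitK (s_f j) (s_m j) (KInvStep Lc j)` reduces, by
the SAME dictionary (`unitK_KInvStep_eq`, `abs_re_latticeKernel_le_of_norm_le`), to the WEAKER fibre statement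

  `∀ j j' ≥ k₀, ∀ legs, ∀ p ∈ BZ, ‖kFib j … p − kFib j' … p‖ ≤ η₀`      (ONE datum beyond `k₀`, no ratio `θ`)

(`supCauchyBand_of_kFib`); with p1's (I3) `UnitDecayK` it gives the pairwise weighted deviations the Cauchy-band theorem consumes
(`cauchyDecays_of_unitDecayK_kFib`).  §2 records that road P1's inputs IMPLY road P4's (`supCauchyBand_of_supRate`: a sup-norm step rate
`c θ^j` gives the Cauchy sup band `2(c/(1−θ))θ^{k₀}` from every `k₀`) — the monotone route asks strictly less of the resolvent slot.  How the fibre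
statement is obtained WITHOUT a rate when the fibre matrices form a Loewner chain is `GAN24/MonotoneLoewner` (trace datum); for the β lane's
bordered KKT presentation the chain property of the gauge∕multiplier rows is the located open step (`HOME/b2b-balaban-gan24-p4/MONOTONE.md` §3).
-/

noncomputable section

open Complex MeasureTheory Finset
open scoped BigOperators
open Literature.MathematicalPhysics.QuantumFieldTheory
open Literature.MathematicalPhysics.QuantumFieldTheory.Balaban1983to89
open Literature.MathematicalPhysics.QuantumFieldTheory.Balaban1983to89.Beta
open B4Strip (ofRealVec)
open B4ContourShift (latticeKernel BZ integrand)
open B4Green242Bridge (latticeKernel_sub)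
open ExpKernelCalculus (MKer Decays)
open OneStepResolventKernel (Fib)
open OneStepKernelFamily (KInvStep)
open Summit.QuantumFields.BalabanUV.Beta.HessKerDressedUnits (unitK)
open Summit.QuantumFields.BalabanUV.Beta.GAN24.CombesThomas (SupBound SupRate SupCauchy UnitDecayK supCauchy_of_supRate)
open Summit.QuantumFields.BalabanUV.Beta.GAN24.CombesThomasFibre (LegOn abs_re_latticeKernel_le_of_norm_le)
open Summit.QuantumFields.BalabanUV.Beta.GAN24.CombesThomasFibreStep (kFib unitK_KInvStep_eq integrableOn_kFib
  integrableOn_norm_of_integrand_zero)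
open Summit.QuantumFields.BalabanUV.Beta.GAN24.MonotoneCauchy (SupCauchyBand cauchyDecays_of_uniform_supCauchyBand)

namespace Summit.QuantumFields.BalabanUV.Beta.GAN24.MonotoneFibre

variable {d : ℕ}

/-! ## §1 (MONO-K)₂ for the step resolvents from ONE real-zone datum on `kFib` -/

section Step

variable {Lc : ℕ} [NeZero Lc]

/-- [folklore] **(MONO-K)₂ AT THE FIBRE LEVEL ⟹ `SupCauchyBand`**: an entrywise real-zone bound `‖kFib j … p − kFib j' … p‖ ≤ η₀` for ALL PAIRS
`j, j' ≥ k₀` (one datum `η₀ ≥ 0`, no ratio) gives `SupCauchyBand (j ↦ unitK (s_f j) (s_m j) (KInvStep Lc j)) η₀ k₀` — the structural input of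
`GAN24/MonotoneCauchy.betaAvgAFH_of_rows_supCauchyBand` for the wall's resolvent slot.  Same dictionary as p1's `supRateK_of_kFib`; nothing estimated. -/
theorem supCauchyBand_of_kFib (sf sm : ℕ → ℝ) {η₀ : ℝ} (hη : 0 ≤ η₀) {k₀ : ℕ}
    (hdev : ∀ j j', k₀ ≤ j → k₀ ≤ j' → ∀ (x' y' : Fin (d + 1) → ℤ) (a b : Fib d), ∀ p ∈ BZ (d + 1),
      ‖kFib Lc sf sm j a x' b y' (ofRealVec p) - kFib Lc sf sm j' a x' b y' (ofRealVec p)‖ ≤ η₀) :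
    SupCauchyBand (fun j => unitK (sf j) (sm j) (KInvStep (d := d) Lc j)) η₀ k₀ := by
  intro j j' hj hj' x' y' a b
  rw [HessKerDressedLimit.mker_sub_apply]
  dsimp only
  rw [unitK_KInvStep_eq, unitK_KInvStep_eq]
  by_cases h : LegOn Lc a x' ∧ LegOn Lc b y'
  · rw [if_pos h, if_pos h, ← Complex.sub_re,
      ← latticeKernel_sub 0 (integrableOn_kFib sf sm j a x' b y' 0) (integrableOn_kFib sf sm j' a x' b y' 0)]
    refine abs_re_latticeKernel_le_of_norm_le _ 0 ?_ (hdev j j' hj hj' x' y' a b)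
    refine integrableOn_norm_of_integrand_zero
      (G := fun P => kFib Lc sf sm j a x' b y' P - kFib Lc sf sm j' a x' b y' P) ?_
    have e : integrand (fun P => kFib Lc sf sm j a x' b y' P - kFib Lc sf sm j' a x' b y' P) 0 =
        fun p => integrand (kFib Lc sf sm j a x' b y') 0 p - integrand (kFib Lc sf sm j' a x' b y') 0 p := by
      funext p; unfold integrand; ring
    rw [e]
    exact (integrableOn_kFib sf sm j a x' b y' 0).sub (integrableOn_kFib sf sm j' a x' b y' 0)
  · rw [if_neg h, if_neg h, sub_zero, abs_zero]
    exact hη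

/-- [folklore] **… + (I3) ⟹ PAIRWISE WEIGHTED DEVIATIONS OF THE STEP RESOLVENTS, NO RATE**: p1's `UnitDecayK d Lc s_f s_m C δ` and the fibre datum
give `Decays (unitK_j (KInvStep Lc j) − unitK_{j'} (KInvStep Lc j')) √(η₀·(C + C)) (δ/2)` for all `j, j' ≥ k₀` (`MonotoneCauchy.cauchyDecays_of_uniform_supCauchyBand`). -/
theorem cauchyDecays_of_unitDecayK_kFib (sf sm : ℕ → ℝ) {C δ η₀ : ℝ} (hK : UnitDecayK d Lc sf sm C δ) (hη : 0 ≤ η₀) {k₀ : ℕ}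
    (hdev : ∀ j j', k₀ ≤ j → k₀ ≤ j' → ∀ (x' y' : Fin (d + 1) → ℤ) (a b : Fib d), ∀ p ∈ BZ (d + 1),
      ‖kFib Lc sf sm j a x' b y' (ofRealVec p) - kFib Lc sf sm j' a x' b y' (ofRealVec p)‖ ≤ η₀) :
    ∀ j j', k₀ ≤ j → k₀ ≤ j' →
      Decays (unitK (sf j) (sm j) (KInvStep (d := d) Lc j) - unitK (sf j') (sm j') (KInvStep (d := d) Lc j'))
        (Real.sqrt (η₀ * (C + C))) (δ / 2) :=
  cauchyDecays_of_uniform_supCauchyBand (A := fun j => unitK (sf j) (sm j) (KInvStep (d := d) Lc j)) hK hη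
    (supCauchyBand_of_kFib sf sm hη hdev)

end Step

/-! ## §2 Road P1's input implies road P4's: a sup-norm step RATE gives the Cauchy sup BAND from every `k₀` -/

section Compare

variable {D : ℕ} {F : Type*}

/-- [folklore] Sup bounds subtract: `SupBound X ε`, `SupBound Y ε′` ⟹ `SupBound (X − Y) (ε + ε′)`. -/
theorem supBound_sub {X Y : MKer D F} {ε ε' : ℝ} (hX : SupBound X ε) (hY : SupBound Y ε') : SupBound (X - Y) (ε + ε') := by
  intro x y a b
  rw [HessKerDressedLimit.mker_sub_apply]
  exact (abs_sub _ _).trans (add_le_add (hX x y a b) (hY x y a b))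

/-- [folklore] **`SupCauchy` ⟹ `SupCauchyBand`**: all-scales sup deviations `c θ^k` from every base `k` give, from the base `k₀`, the pairwise band
`2·c·θ^{k₀}` (`0 ≤ θ`): `K j − K j' = (K j − K k₀) − (K j' − K k₀)`. -/
theorem supCauchyBand_of_supCauchy {K : ℕ → MKer D F} {c θ : ℝ} (h : SupCauchy K c θ) (k₀ : ℕ) :
    SupCauchyBand K (c * θ ^ k₀ + c * θ ^ k₀) k₀ := by
  intro j j' hj hj'
  have h1 : SupBound (K j - K k₀) (c * θ ^ k₀) := by
    have := h k₀ (j - k₀); rwa [Nat.add_sub_cancel' hj] at this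
  have h2 : SupBound (K j' - K k₀) (c * θ ^ k₀) := by
    have := h k₀ (j' - k₀); rwa [Nat.add_sub_cancel' hj'] at this
  have e : K j - K j' = (K j - K k₀) - (K j' - K k₀) := by abel
  rw [e]
  exact supBound_sub h1 h2

/-- [folklore] **ROAD P1 ⟹ ROAD P4 at the resolvent slot**: a ONE-STEP sup-norm rate `SupRate K c θ` (`0 ≤ c`, `0 ≤ θ < 1`; p1's (I2) shape) gives the
Cauchy sup band `2(c/(1−θ))·θ^{k₀}` from EVERY `k₀` (p1's `supCauchy_of_supRate` + the previous lemma).  The converse fails (a band carries no ratio):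
the monotone route asks strictly less of the slot. -/
theorem supCauchyBand_of_supRate {K : ℕ → MKer D F} {c θ : ℝ} (h : SupRate K c θ) (hc : 0 ≤ c) (hθ0 : 0 ≤ θ) (hθ1 : θ < 1)
    (k₀ : ℕ) : SupCauchyBand K (c / (1 - θ) * θ ^ k₀ + c / (1 - θ) * θ ^ k₀) k₀ :=
  supCauchyBand_of_supCauchy (supCauchy_of_supRate h hc hθ0 hθ1) k₀

end Compare

end Summit.QuantumFields.BalabanUV.Beta.GAN24.MonotoneFibre

end
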